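import Summits.SmoothPoincare4.SmoothPoincare4.Theorems.ConvexBisectionAcyclicBisectionExistsComplementPieceHandleBall
import HarnessLib

/-!
# The complement piece `W₂`, IIb: the handle chart of Milnor's gluing, extended across the seam
(helper file 2b of the wave-4 brick T3b (iii) "the complement piece `W₂ = {Φ ≤ 0}` of the pushed
prefix sub-handlebody inside Milnor's gluing" for stub `stub_steinRealisation` (NF6), line
`modp-braid-orbits` r11, crux `ConvexBisection.AcyclicBisectionExists`, item stmt-SmoothPoincare4-10508;
lead c5, worker Y6)

Let `X = B ∪_{h̄} (handles)` (data `D`), `M' = X ∪_Ψ W = G.d₂.Glued` Milnor's gluing built from an open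
collar `G.CM` adapted to the belt map of the `i`-th handle (`…DualHandleGluingCollars.lean`).  In
Kosinski's coordinates `x = (x_λ, x_μ) ∈ ℝ⁴` of the `i`-th handle (`D.jB i : D⁴ ∖ S → X`) this file
builds ONE chart `ℝ⁴ ⊇ 𝓥 → M'` covering the open handle AND a neighbourhood of the belt circle across
the seam (V5-REPORT §3.0: "extend `Ξ` to `𝓞 ∪ ({r < 1} ∖ S)` by `G.jM ∘ D.jB j`"):

* `beltBallPt x ∈ D⁴ ∖ S` — the belt-piece point with vector `x` (`‖x‖ < 1`), smooth on the open ball;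
* `handleBallChart D i G x = G.jM (D.jB i (beltBallPt x))` — the open handle in `M'`: smooth and
  injective on the open unit ball, a smooth embedding with open range on every open subset of it
  (`isSmoothEmbedding_handleBallChart`: inverse `jB⁻¹ ∘ jM⁻¹` smooth by
  `contMDiffOn_leftInverse_of_isImmersion`);
* `seamZone a = {x_μ ≠ 0, ‖x_λ‖ < ½, |1 - ‖x‖²| < min (1/5) a}`, `chartDom a = ball ∪ seamZone a`;
* **`gluedHandleChart D i G a x`** `= handleBallChart x` for `‖x‖ < 1`, `= modelChart D i G a x` (the seam
  chart `ι (seamPt x, seamHeight a x)` of `…DualHandleSeamModelChart.lean`) otherwise; on the seam zone it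
  IS the model chart (`gluedHandleChart_of_mem_seamZone`, by `modelChart_of_norm_le_one`), hence smooth
  and injective on `chartDom a`, and around every point of `chartDom a` it restricts to a smooth
  embedding with open range (`exists_isSmoothEmbedding_gluedHandleChart`);
* the charts of two different handles have disjoint images (`gluedHandleChart_ne`).

This is the chart in which the level function `Φ` of the complement piece is written near the `i`-th
cocore (files III–IV).  Everything here is proved; no named facts.

## References
* A. A. Kosinski, *Differential Manifolds* (1993), VI §6. [Kosinski1993]
* J. Milnor, *Lectures on the h-cobordism theorem* (1965), Thm. 1.4. [MilnorHCobordism1965]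
* J. M. Lee, *Introduction to Smooth Manifolds* (2013), Prop. 5.2, Thm. 4.14. [LeeSmoothManifolds2013]
-/

noncomputable section

-- the prescribed namespace `Summit.<P>.<Sub>.…` duplicates `SmoothPoincare4` (P = Sub)
set_option linter.dupNamespace false

open scoped Manifold ContDiff Topology

namespace Summit.SmoothPoincare4.SmoothPoincare4.Theorems.AcyclicBisectionExists.ModpBraidOrbits

open Set Function Metric Topology
open Literature.Topology.FourManifolds Literature.Topology.FourManifolds.HandleAttachingMap

/-! ### §2 The glued handle chart -/

section Glued

/-- **The seam zone** `{x_μ ≠ 0, ‖x_λ‖ < ½, |1 - ‖x‖²| < min (1/5) a}` around the belt circle, on which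
the model chart is the handle chart for `‖x‖ ≤ 1` (`modelChart_of_norm_le_one`). [folklore] -/
def seamZone (a : ℝ) : Set (EuclideanSpace ℝ (Fin 4)) :=
  {x | muPart x ≠ 0 ∧ ‖lamPart x‖ < 1 / 2 ∧ |1 - ‖x‖ ^ 2| < min (1 / 5) a}

/-- The seam zone is open. [folklore] -/
theorem isOpen_seamZone (a : ℝ) : IsOpen (seamZone a) := by
  refine (isOpen_ne.preimage contDiff_muPart.continuous).inter
    ((isOpen_lt (continuous_norm.comp contDiff_lamPart.continuous) continuous_const).inter
      (isOpen_lt (continuous_abs.comp (continuous_const.sub (continuous_norm.pow 2))) continuous_const))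

/-- The seam zone lies in the seam locus of the model chart. [folklore] -/
theorem seamZone_subset (a : ℝ) :
    seamZone a ⊆ {x | muPart x ≠ 0 ∧ ‖lamPart x‖ < 1 ∧ 1 - ‖x‖ ^ 2 < a} := fun x hx =>
  ⟨hx.1, by linarith [hx.2.1], (abs_lt.1 hx.2.2).2.trans_le (min_le_right _ _)⟩

/-- Depth bounds on the seam zone. [folklore] -/
theorem depth_of_mem_seamZone {a : ℝ} {x : EuclideanSpace ℝ (Fin 4)} (hx : x ∈ seamZone a) :
    1 - ‖x‖ ^ 2 ≤ min (1 / 5) a ∧ 1 - ‖x‖ ^ 2 < a :=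
  ⟨(abs_lt.1 hx.2.2).2.le, (abs_lt.1 hx.2.2).2.trans_le (min_le_right _ _)⟩

/-- **The chart domain**: the open unit ball together with the seam zone. [folklore] -/
def chartDom (a : ℝ) : Set (EuclideanSpace ℝ (Fin 4)) := ball 0 1 ∪ seamZone a

/-- The chart domain is open. [folklore] -/
theorem isOpen_chartDom (a : ℝ) : IsOpen (chartDom a) := isOpen_ball.union (isOpen_seamZone a)

variable {B : Type} [TopologicalSpace B] [T2Space B] [ChartedSpace (EuclideanHalfSpace 4) B]
  {ι : Type} [Finite ι] {h : ι → HandleAttachingMap 3 2 B}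
  {X : Type} [TopologicalSpace X] [ChartedSpace (EuclideanHalfSpace 4) X] [IsManifold (𝓡∂ 4) ∞ X]
  (D : MultiAttachmentData h (𝓡∂ 4) X) (i : ι) {bX : BoundaryData (𝓡∂ 4) X (𝓡 3)}
  {W : Type} [TopologicalSpace W] [ChartedSpace (EuclideanHalfSpace 4) W]
  [IsManifold (𝓡∂ 4) ∞ W] {bW : BoundaryData (𝓡∂ 4) W (𝓡 3)} [Nonempty bX.carrier]
  (G : BoundaryGlueData bX bW) (a : ℝ)

open Classical in
/-- **THE GLUED HANDLE CHART of `M' = X ∪_Ψ W` around the `i`-th cocore**: the open handle on the open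
unit ball, the seam chart `modelChart` elsewhere. [cite: MilnorHCobordism1965, Thm. 1.4] -/
def gluedHandleChart (x : EuclideanSpace ℝ (Fin 4)) : G.d₂.Glued :=
  if ‖x‖ < 1 then handleBallChart D i G x else modelChart D i G a x

/-- On the open ball the glued chart is the open handle. [folklore] -/
theorem gluedHandleChart_of_norm_lt_one {x : EuclideanSpace ℝ (Fin 4)} (hx : ‖x‖ < 1) :
    gluedHandleChart D i G a x = G.jM (D.jB i (beltBallPt x)) := by
  rw [gluedHandleChart, if_pos hx]; rfl

/-- Off the open ball the glued chart is the model chart. [folklore] -/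
theorem gluedHandleChart_of_one_le_norm {x : EuclideanSpace ℝ (Fin 4)} (hx : 1 ≤ ‖x‖) :
    gluedHandleChart D i G a x = modelChart D i G a x := by
  rw [gluedHandleChart, if_neg (not_lt.2 hx)]

variable {a}

/-- The adaptedness hypothesis of the collar `G.CM` to the belt map of the `i`-th handle
(`exists_openCollar_adapted`, `exists_standardForm`). [folklore] -/
def CollarAdapted (D : MultiAttachmentData h (𝓡∂ 4) X) (i : ι) (G : BoundaryGlueData bX bW) (a : ℝ) : Prop :=
  ∀ (θ : sphere (0 : EuclideanSpace ℝ (Fin 2)) 1) (v : EuclideanSpace ℝ (Fin 2)), ‖v‖ ≤ 1 / 2 →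
    ∀ z : bX.carrier, bX.incl z = (beltMap D i).toFun (depthLine θ v 0) →
    ∀ s : ℝ, 0 ≤ s → collarStretch a s ≤ min (1 / 5) a →
      G.CM.toFun z s = (beltMap D i).toFun (depthLine θ v (collarStretch a s))

/-- **On belt-piece points of the chart domain the glued chart IS the handle chart `j_M ∘ D.jB i`**
(interior points by definition, seam-zone sphere points by `modelChart_of_norm_le_one`). [cite: Kosinski1993, VI §6] -/
theorem gluedHandleChart_coe (ha : 0 < a) (hCM : CollarAdapted D i G a) (b : ↥(beltPiece 3 2))
    (hb : ((b : closedBall (0 : EuclideanSpace ℝ (Fin 4)) 1) : EuclideanSpace ℝ (Fin 4)) ∈ chartDom a) :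
    gluedHandleChart D i G a ((b : closedBall (0 : EuclideanSpace ℝ (Fin 4)) 1) : EuclideanSpace ℝ (Fin 4)) =
      G.jM (D.jB i b) := by
  set x := ((b : closedBall (0 : EuclideanSpace ℝ (Fin 4)) 1) : EuclideanSpace ℝ (Fin 4)) with hx
  by_cases h1 : ‖x‖ < 1
  · rw [gluedHandleChart_of_norm_lt_one D i G a h1, beltBallPt_coe b h1]
  · have hle : ‖x‖ ≤ 1 := mem_closedBall_zero_iff.1 b.1.2
    have hxs : x ∈ seamZone a := hb.resolve_left (fun h' => h1 (mem_ball_zero_iff.1 h'))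
    rw [gluedHandleChart_of_one_le_norm D i G a (not_lt.1 h1),
      modelChart_of_norm_le_one D i bX G ha hCM hxs.1 hxs.2.1.le hle (depth_of_mem_seamZone hxs).1
        (depth_of_mem_seamZone hxs).2]

/-- **On the seam zone the glued chart IS the model chart.** [cite: MilnorHCobordism1965, Thm. 1.4] -/
theorem gluedHandleChart_of_mem_seamZone (ha : 0 < a) (hCM : CollarAdapted D i G a)
    {x : EuclideanSpace ℝ (Fin 4)} (hx : x ∈ seamZone a) :
    gluedHandleChart D i G a x = modelChart D i G a x := by
  by_cases h1 : ‖x‖ < 1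
  · rw [gluedHandleChart_of_norm_lt_one D i G a h1,
      modelChart_of_norm_le_one D i bX G ha hCM hx.1 hx.2.1.le h1.le (depth_of_mem_seamZone hx).1
        (depth_of_mem_seamZone hx).2]
    congr 1
    congr 1
    exact Subtype.ext (Subtype.ext (coe_beltBallPt h1))
  · exact gluedHandleChart_of_one_le_norm D i G a (not_lt.1 h1)

/-- On the seam zone the glued chart is the seam point `ι (seamPt x, seamHeight a x)`. [folklore] -/
theorem gluedHandleChart_eq_inl_inl (ha : 0 < a) (hCM : CollarAdapted D i G a)
    {x : EuclideanSpace ℝ (Fin 4)} (hx : x ∈ seamZone a) :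
    gluedHandleChart D i G a x = G.d₂.inl (G.d₁.inl (seamPt D i bX x, seamHeight a x)) :=
  gluedHandleChart_of_mem_seamZone D i G ha hCM hx

/-- **Outside the closed ball the glued chart lands in the interior of `W`**: for `1 < ‖x‖` in the seam
zone, `gluedHandleChart x = j_N c` with `c` an interior point of `W`. [cite: MilnorHCobordism1965, Thm. 1.4] -/
theorem exists_gluedHandleChart_eq_jN {x : EuclideanSpace ℝ (Fin 4)} (hx : x ∈ seamZone a) (h1 : 1 < ‖x‖) :
    ∃ c : W, (𝓡∂ 4).IsInteriorPoint c ∧ gluedHandleChart D i G a x = G.jN c := by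
  have hda := (depth_of_mem_seamZone hx).2
  have hs : seamHeight a x < 0 := by
    have h2 : 1 < ‖x‖ ^ 2 := by nlinarith
    exact div_neg_of_neg_of_pos (by linarith) (by linarith)
  refine ⟨G.CN.toFun (G.φ (seamPt D i bX x)) (-seamHeight a x), G.CN.isInteriorPoint_apply _ (by linarith), ?_⟩
  rw [gluedHandleChart_of_one_le_norm D i G a h1.le, modelChart_of_one_le_norm D i bX G h1.le hda]

variable [CompactSpace X] [T2Space X] [T2Space W]

/-- **The glued chart is smooth on the chart domain.** [folklore] -/
theorem contMDiffOn_gluedHandleChart (ha : 0 < a) (hCM : CollarAdapted D i G a) :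
    ContMDiffOn 𝓘(ℝ, EuclideanSpace ℝ (Fin 4)) (𝓡 4) ∞ (gluedHandleChart D i G a) (chartDom a) := by
  intro x hx
  apply ContMDiffAt.contMDiffWithinAt
  rcases hx with hx | hx
  · have h := (contMDiffOn_handleBallChart D i G).contMDiffAt (isOpen_ball.mem_nhds hx)
    refine h.congr_of_eventuallyEq ?_
    filter_upwards [isOpen_ball.mem_nhds hx] with y hy
    exact gluedHandleChart_of_norm_lt_one D i G a (mem_ball_zero_iff.1 hy)
  · have h := ((contMDiffOn_modelChart D i bX G a).mono (seamZone_subset a)).contMDiffAt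
      ((isOpen_seamZone a).mem_nhds hx)
    refine h.congr_of_eventuallyEq ?_
    filter_upwards [(isOpen_seamZone a).mem_nhds hx] with y hy
    exact gluedHandleChart_of_mem_seamZone D i G ha hCM hy

omit [CompactSpace X] [T2Space X] [T2Space W] in
/-- A point `j_M (D.jB i b)` is not `j_N` of an interior point of `W`. [folklore] -/
theorem jM_ne_jN_of_isInteriorPoint (y : X) {c : W} (hc : (𝓡∂ 4).IsInteriorPoint c) : G.jM y ≠ G.jN c := by
  intro heq
  obtain ⟨z, -, rfl⟩ := G.jM_eq_jN_iff.1 heq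
  exact ((𝓡∂ 4).isInteriorPoint_iff_not_isBoundaryPoint _).1 hc (bW.incl_mem_boundary _)

omit [CompactSpace X] [T2Space X] [T2Space W] in
/-- **The glued chart is injective on the chart domain.** [folklore] -/
theorem injOn_gluedHandleChart (ha : 0 < a) (hCM : CollarAdapted D i G a) :
    InjOn (gluedHandleChart D i G a) (chartDom a) := by
  -- a seam-zone point off the open ball is `jM (jB b)` (sphere) or `jN (interior)` (outside)
  have key : ∀ {x y : EuclideanSpace ℝ (Fin 4)}, ‖x‖ < 1 → y ∈ seamZone a →
      gluedHandleChart D i G a x = gluedHandleChart D i G a y → x = y := by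
    intro x y hx hy hxy
    by_cases hy1 : ‖y‖ < 1
    · exact injOn_handleBallChart D i G (mem_ball_zero_iff.2 hx) (mem_ball_zero_iff.2 hy1)
        (by rwa [gluedHandleChart_of_norm_lt_one D i G a hx, gluedHandleChart_of_norm_lt_one D i G a hy1] at hxy)
    rcases (not_lt.1 hy1).eq_or_lt with hy1' | hy1'
    · -- sphere point: `modelChart y = jM (jB ⟨y⟩)`
      set b : ↥(beltPiece 3 2) := ⟨⟨y, mem_closedBall_zero_iff.2 hy1'.symm.le⟩, by
        rw [mem_beltPiece, ← norm_lamPart_sq]; intro h'; nlinarith [hy.2.1, norm_nonneg (lamPart y)]⟩ with hb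
      have hyb : gluedHandleChart D i G a y = G.jM (D.jB i b) :=
        gluedHandleChart_coe D i G ha hCM b (Or.inr hy)
      rw [gluedHandleChart_of_norm_lt_one D i G a hx, hyb] at hxy
      have := (D.hjB i).1.isEmbedding.injective (G.injective_jM hxy)
      rw [← coe_beltBallPt hx, this]
    · obtain ⟨c, hc, hyc⟩ := exists_gluedHandleChart_eq_jN D i G hy hy1'
      rw [gluedHandleChart_of_norm_lt_one D i G a hx, hyc] at hxy
      exact absurd hxy (jM_ne_jN_of_isInteriorPoint G _ hc)
  intro x hx y hy hxy
  rcases hx with hx | hx <;> rcases hy with hy | hy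
  · rw [mem_ball_zero_iff] at hx hy
    rw [gluedHandleChart_of_norm_lt_one D i G a hx, gluedHandleChart_of_norm_lt_one D i G a hy] at hxy
    exact injOn_handleBallChart D i G (mem_ball_zero_iff.2 hx) (mem_ball_zero_iff.2 hy) hxy
  · exact key (mem_ball_zero_iff.1 hx) hy hxy
  · exact (key (mem_ball_zero_iff.1 hy) hx hxy.symm).symm
  · rw [gluedHandleChart_of_mem_seamZone D i G ha hCM hx, gluedHandleChart_of_mem_seamZone D i G ha hCM hy] at hxy
    exact injOn_modelChart D i bX G ha (seamZone_subset a hx) (seamZone_subset a hy) hxy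

/-- **Around every point of the chart domain the glued chart restricts to a smooth embedding with open
range** of an open subset of `ℝ⁴` into `M'`. [cite: LeeSmoothManifolds2013, Thm. 4.14] -/
theorem exists_isSmoothEmbedding_gluedHandleChart (ha : 0 < a) (hCM : CollarAdapted D i G a)
    {x : EuclideanSpace ℝ (Fin 4)} (hx : x ∈ chartDom a) :
    ∃ U : TopologicalSpace.Opens (EuclideanSpace ℝ (Fin 4)), x ∈ U ∧ (U : Set (EuclideanSpace ℝ (Fin 4))) ⊆ chartDom a ∧
      Manifold.IsSmoothEmbedding 𝓘(ℝ, EuclideanSpace ℝ (Fin 4)) (𝓡 4) ∞ (fun y : U => gluedHandleChart D i G a y) ∧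
      IsOpen (range fun y : U => gluedHandleChart D i G a y) := by
  rcases hx with hx | hx
  · set U : TopologicalSpace.Opens (EuclideanSpace ℝ (Fin 4)) := ⟨ball 0 1, isOpen_ball⟩ with hU
    haveI : Nonempty U := ⟨⟨x, hx⟩⟩
    have heq : (fun y : U => gluedHandleChart D i G a y) = fun y : U => handleBallChart D i G y :=
      funext fun y => gluedHandleChart_of_norm_lt_one D i G a (mem_ball_zero_iff.1 y.2)
    refine ⟨U, hx, subset_union_left, ?_⟩
    rw [heq]
    exact isSmoothEmbedding_handleBallChart D i G U subset_rfl
  · set U : TopologicalSpace.Opens (EuclideanSpace ℝ (Fin 4)) := ⟨seamZone a, isOpen_seamZone a⟩ with hU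
    haveI : Nonempty U := ⟨⟨x, hx⟩⟩
    have heq : (fun y : U => gluedHandleChart D i G a y) = fun y : U => modelChart D i G a y :=
      funext fun y => gluedHandleChart_of_mem_seamZone D i G ha hCM y.2
    refine ⟨U, hx, subset_union_right, ?_⟩
    rw [heq]
    exact isSmoothEmbedding_modelChart D i G ha U (seamZone_subset a)

omit [CompactSpace X] [T2Space X] [T2Space W] in
/-- **The glued charts of two different handles have disjoint images** (disjoint handles in `X`,
disjoint belt maps under the seam points, and `j_M (X) ∩ j_N (W ∖ ∂W) = ∅`). [cite: Kosinski1993, VI §6] -/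
theorem gluedHandleChart_ne (ha : 0 < a) {i i' : ι} (hii' : i ≠ i') (hCM : CollarAdapted D i G a)
    (hCM' : CollarAdapted D i' G a) {x x' : EuclideanSpace ℝ (Fin 4)} (hx : x ∈ chartDom a)
    (hx' : x' ∈ chartDom a) : gluedHandleChart D i G a x ≠ gluedHandleChart D i' G a x' := by
  -- a chart point is `jM (jB b)`, or a seam point `ι (seamPt, seamHeight)` of its handle
  have shape : ∀ (k : ι), CollarAdapted D k G a → ∀ {y : EuclideanSpace ℝ (Fin 4)}, y ∈ chartDom a →
      (∃ b, gluedHandleChart D k G a y = G.jM (D.jB k b)) ∨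
        (y ∈ seamZone a ∧ gluedHandleChart D k G a y = G.d₂.inl (G.d₁.inl (seamPt D k bX y, seamHeight a y))) := by
    intro k hk y hy
    by_cases hy1 : ‖y‖ < 1
    · exact Or.inl ⟨_, gluedHandleChart_of_norm_lt_one D k G a hy1⟩
    · have hys : y ∈ seamZone a := hy.resolve_left fun h' => hy1 (mem_ball_zero_iff.1 h')
      exact Or.inr ⟨hys, gluedHandleChart_eq_inl_inl D k G ha hk hys⟩
  -- seam points of different handles differ (disjoint belt maps)
  have hseam : ∀ {y y' : EuclideanSpace ℝ (Fin 4)},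
      G.d₂.inl (G.d₁.inl (seamPt D i bX y, seamHeight a y)) ≠
        G.d₂.inl (G.d₁.inl (seamPt D i' bX y', seamHeight a y')) := by
    intro y y' heq
    have h1 : seamPt D i bX y = seamPt D i' bX y' := (Prod.ext_iff.1 (G.d₁.inl_injective (G.d₂.inl_injective heq))).1
    have h2 := incl_seamPt D i bX y
    rw [h1, incl_seamPt D i' bX y'] at h2
    exact (pairwise_disjoint_range_beltMap D hii'.symm).ne_of_mem (mem_range_self _) (mem_range_self _) h2
  -- a seam point off the ball of handle `k` vs a handle point `jM (jB_l b)` of another handle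
  have hmixed : ∀ {k l : ι}, k ≠ l → CollarAdapted D k G a → ∀ {y : EuclideanSpace ℝ (Fin 4)}, y ∈ seamZone a →
      ∀ b : ↥(beltPiece 3 2), gluedHandleChart D k G a y ≠ G.jM (D.jB l b) := by
    intro k l hkl hk y hy b heq
    by_cases hy1 : ‖y‖ ≤ 1
    · set b' : ↥(beltPiece 3 2) := ⟨⟨y, mem_closedBall_zero_iff.2 hy1⟩, by
        rw [mem_beltPiece, ← norm_lamPart_sq]; intro h'; nlinarith [hy.2.1, norm_nonneg (lamPart y)]⟩ with hb'
      rw [gluedHandleChart_coe D k G ha hk b' (Or.inr hy)] at heq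
      exact (D.disjointB hkl).ne_of_mem (mem_range_self _) (mem_range_self _) (G.injective_jM heq)
    · obtain ⟨c, hc, hyc⟩ := exists_gluedHandleChart_eq_jN D k G hy (not_le.1 hy1)
      rw [hyc] at heq
      exact jM_ne_jN_of_isInteriorPoint G _ hc heq.symm
  intro heq
  rcases shape i hCM hx with ⟨b, hb⟩ | ⟨hxs, hxe⟩ <;> rcases shape i' hCM' hx' with ⟨b', hb'⟩ | ⟨hxs', hxe'⟩
  · rw [hb, hb'] at heq
    exact (D.disjointB hii').ne_of_mem (mem_range_self _) (mem_range_self _) (G.injective_jM heq)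
  · exact hmixed hii'.symm hCM' hxs' b (hb ▸ heq).symm
  · exact hmixed hii' hCM hxs b' (hb' ▸ heq)
  · exact hseam (hxe ▸ hxe' ▸ heq)

/-- **Registered helper `helper_gluedHandleChart_local_embedding` (sub-goal of `stub_steinRealisation`,
T3b (iii), wave 4, lead c5): the glued handle chart of Milnor's gluing around a cocore is a smooth
injective map on `chartDom a` which is a local smooth embedding with open range, and equals the handle
chart `j_M ∘ D.jB i` on belt-piece points.** [cite: LeeSmoothManifolds2013, Thm. 4.14] -/
theorem helper_gluedHandleChart_local_embedding : ∀ {B : Type} [TopologicalSpace B] [T2Space B] [ChartedSpace (EuclideanHalfSpace 4) B] {ι : Type} [Finite ι] {h : ι → Literature.Topology.FourManifolds.HandleAttachingMap 3 2 B} {X : Type} [TopologicalSpace X] [ChartedSpace (EuclideanHalfSpace 4) X] [IsManifold (𝓡∂ 4) ∞ X] (D : Literature.Topology.FourManifolds.HandleAttachingMap.MultiAttachmentData h (𝓡∂ 4) X) (i : ι) {bX : Literature.Topology.FourManifolds.BoundaryData (𝓡∂ 4) X (𝓡 3)} {W : Type} [TopologicalSpace W] [ChartedSpace (EuclideanHalfSpace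 4) W] [IsManifold (𝓡∂ 4) ∞ W] {bW : Literature.Topology.FourManifolds.BoundaryData (𝓡∂ 4) W (𝓡 3)} [Nonempty bX.carrier] (G : Literature.Topology.FourManifolds.BoundaryGlueData bX bW) {a : ℝ} [CompactSpace X] [T2Space X] [T2Space W], 0 < a → Summit.SmoothPoincare4.SmoothPoincare4.Theorems.AcyclicBisectionExists.ModpBraidOrbits.CollarAdapted D i G a → Set.InjOn (Summit.SmoothPoincare4.SmoothPoincare4.Theorems.AcyclicBisectionExists.ModpBraidOrbits.gluedHandleChart D i G a) (Summit.SmoothPoincare4.SmoothPoincare4.Theorems.AcyclicBisectionExists.ModpBraidOrbits.chartDom a) ∧ ContMDiffOn 𝓘(ℝ, EuclideanSpace ℝ (Fin 4)) (𝓡 4) ∞ (Summit.SmoothPoincare4.SmoothPoincare4.Theorems.AcyclicBisectionExists.ModpBraidOrbits.gluedHandleChart D i G a) (Summit.SmoothPoincare4.SmoothPoincare4.Theorems.AcyclicBisectionExists.ModpBraidOrbits.chartDom a) ∧ (∀ x ∈ Summit.SmoothPoincare4.SmoothPoincare4.Theorems.AcyclicBisectionExists.ModpBraidOrbits.chartDom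 a, ∃ U : TopologicalSpace.Opens (EuclideanSpace ℝ (Fin 4)), x ∈ U ∧ (U : Set (EuclideanSpace ℝ (Fin 4))) ⊆ Summit.SmoothPoincare4.SmoothPoincare4.Theorems.AcyclicBisectionExists.ModpBraidOrbits.chartDom a ∧ Manifold.IsSmoothEmbedding 𝓘(ℝ, EuclideanSpace ℝ (Fin 4)) (𝓡 4) ∞ (fun y : U => Summit.SmoothPoincare4.SmoothPoincare4.Theorems.AcyclicBisectionExists.ModpBraidOrbits.gluedHandleChart D i G a y) ∧ IsOpen (Set.range fun y : U => Summit.SmoothPoincare4.SmoothPoincare4.Theorems.AcyclicBisectionExists.ModpBraidOrbits.gluedHandleChart D i G a y)) ∧ (∀ b : ↥(Literature.Topology.FourManifolds.beltPiece 3 2), ((b : Metric.closedBall (0 : EuclideanSpace ℝ (Fin 4)) 1) : EuclideanSpace ℝ (Fin 4)) ∈ Summit.SmoothPoincare4.SmoothPoincare4.Theorems.AcyclicBisectionExists.ModpBraidOrbits.chartDom a → Summit.SmoothPoincare4.SmoothPoincare4.Theorems.AcyclicBisectionExists.ModpBraidOrbits.gluedHandleChart D i G a ((b : Metric.closedBall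 (0 : EuclideanSpace ℝ (Fin 4)) 1) : EuclideanSpace ℝ (Fin 4)) = G.jM (D.jB i b)) := by
  intro B _ _ _ ι _ h X _ _ _ D i bX W _ _ _ bW _ G a _ _ _ ha hCM
  exact ⟨injOn_gluedHandleChart D i G ha hCM, contMDiffOn_gluedHandleChart D i G ha hCM,
    fun x hx => exists_isSmoothEmbedding_gluedHandleChart D i G ha hCM hx,
    fun b hb => gluedHandleChart_coe D i G ha hCM b hb⟩

end Glued

end Summit.SmoothPoincare4.SmoothPoincare4.Theorems.AcyclicBisectionExists.ModpBraidOrbits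

end
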